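import Summits.BirchSwinnertonDyer.BirchSwinnertonDyer.Theorems.UniversalToricDescentBDPFrameCrossPeriodRigidity
import Summits.BirchSwinnertonDyer.BirchSwinnertonDyer.Theorems.UniversalToricDescentAdditiveSplitIMCInclusionAtThreeStubLineRestrictionIsBDP
import HarnessLib

/-!
# Line `thin_comb` on THE WALL `AdditiveSplitIMCInclusionAtThree` (stmt-BirchSwinnertonDyer-20395): the Rankin–Selberg
# continuation (stub K3c `stub_rankinSelbergContinuation`, Jacquet 1972) is NOT NEEDED — cross-period rigidity of the handed BDP
# frame against a CONTINUATION-CONDITIONAL frame, by the junk dichotomy (`--supports stmt-BirchSwinnertonDyer-20395`; cell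
# `pub/bsd-wall`, lead `cruxlead-20395` g4; any prime `p`; sorry-free; no named fact; imports no `Theses` module)

WHY. In v5 of the line, K3b (`…ThinCombLine.stub_lineRestrictionIsBDP`, p704137) turns a toric two-variable frame `L₂`
(`IsToricTwoVarLFunction`) into a BDP frame `IsBDPLFunction … (spec (p^k) L₂)` GIVEN the entire continuation of `L(f/K, φ, s)`
for EVERY everywhere-unramified `φ` of type `(n, −n)` (K3c = `jacquet1972_exists_entire_rankinSelbergHecke`), because the tree's
special value `rankinSelbergValueHecke f φ 1` is the JUNK value `0` at a `φ` without continuation (then every `L₀` is a value of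
"the" continuation, so the `∃!` in its definition fails), where the toric frame prescribes nothing. This file removes the
hypothesis: the handed frame `L` of the crux satisfies `IsBDPLFunction` UNCONDITIONALLY, so along the tree's character supply
`φ₀^{p^k}` (`CongruentShaFreeCutCharacterSupply.characterSupplyAt`, every prime) EITHER the continuation fails at infinitely many
supplied characters — then `L` vanishes at infinitely many points accumulating at `T = 0`, hence `L = 0` (identity principle
`X11b.unrSeries_eq_of_hasValueAt`) and the crux's inclusion `(L) ⊆ …` is `⊥ ≤ …` — OR it holds at all supplied characters from
some index on, and then cn100's LEMMA R∞ chain, run on the shifted supply at the level of VALUES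
(`CongruentShaFreeCutBDPUpToPowerMapIdentity.powerMap_identity_of_values`,
`CongruentShaFreeCutPowerMapSeriesRigidity.exists_C_pow_mul_eq_of_powerMap_identity`, and the `a = b` evaluation argument of
`UniversalToricDescentTwinSplit.span_singleton_eq_of_isBDPLFunction`, p536114 — reproduced here against a frame that is only
asked for values at characters ADMITTING a continuation), gives `Ideal.span {L′} = Ideal.span {L}`.

* §1 `rankinSelbergValueHecke_eq_zero_of_not_exists` (the junk value), `bdpInterpolationValue_eq_zero_of_not_exists`.
* §2 **`eq_zero_or_span_singleton_eq_of_isBDPLFunction_of_cont`** (any prime `p`; `K` imaginary quadratic, `κ` anticyclotomic,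
  `γ` a topological generator, periods `Ω_K, Ω′_K ∈ ℂˣ`, `Ω_p, Ω′_p ∈ ℂ_pˣ` arbitrary): for `L` with `IsBDPLFunction ι 𝔭 κ γ f Ω_K Ω_p L`
  and `L′` carrying the BDP values at `(Ω′_K, Ω′_p)` at every character of the range THAT ADMITS AN ENTIRE CONTINUATION of
  `L(f/K, φ, s)`: `L = 0 ∨ Ideal.span {L′} = Ideal.span {L}`.
* §3 **`eq_zero_or_span_spec_eq_of_toric`**: in a v2 frame (`γ₁γ⁻¹, γ₂(γ^{p^k})⁻¹ ∈ ker κ`) of the `ℤ_p²`-tower with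
  `p = 𝔭𝔭′` split, a toric frame `L₂` at `(Ω′_K, Ω′_p)` and the handed BDP frame `L` satisfy
  `L = 0 ∨ Ideal.span {spec (p^k) L₂} = Ideal.span {L}` — the pointwise content of K3b's proof (tree lemmas
  `IsToricTwoVarLFunction.hasValueAt₂_centralRay`, `LineGeometry.interpolationPoint_mem_line`, `LineValue.hasValueAt₂_line_iff_hasValueAt_spec`,
  `KatzLineFrame.*` reciprocity `φ(𝔭′) = φ(𝔭)⁻¹`) fed to §2. With it the line's composition needs neither K3b's continuation
  hypothesis nor K3c (skeleton v6).

References: [Castella2018] Thm. 3.1 (arXiv:1704.06608 p. 9); [CastellaWan2023] Cor. 2.12 (arXiv:1607.02019 §2.4); [Washington1997]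
§7.1–7.2; [Nekovar1995] §1.6–1.7 (the continuation whose ABSENCE is the junk branch). Nothing about BSD is proved here.
-/

noncomputable section

open scoped Classical Topology

set_option linter.dupNamespace false
set_option autoImplicit false

namespace Summit.BirchSwinnertonDyer.BirchSwinnertonDyer.Theorems.UniversalToricDescentThinComb.ContRigidity

open Filter PowerSeries NumberField IsDedekindDomain Field
  Literature.NumberTheory.EllipticCurves Literature.NumberTheory.EllipticCurves.ModularForms
  Literature.NumberTheory.GaloisRepresentations
  Summit.BirchSwinnertonDyer.Rank1Residual.X11b
  Summit.BirchSwinnertonDyer.Rank1Residual.X11b.Halves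
  Summit.BirchSwinnertonDyer.BirchSwinnertonDyer.Theorems.CongruentShaFreeCutCharacterSupply
  Summit.BirchSwinnertonDyer.BirchSwinnertonDyer.Theorems.CongruentShaFreeCutBDPUpToPowerMapIdentity
  Summit.BirchSwinnertonDyer.BirchSwinnertonDyer.Theorems.CongruentShaFreeCutPowerMapSeriesRigidity
  Summit.BirchSwinnertonDyer.BirchSwinnertonDyer.Theorems.UniversalToricDescentTwinSplit
open Summit.BirchSwinnertonDyer.BirchSwinnertonDyer.Theorems.CongruentShaFreeCutUnrSeriesWeierstrass
  (coe_natCast_pow)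

/-! ## §1 The junk value of `rankinSelbergValueHecke` at a character without continuation -/

section Junk

variable {K : Type} [Field K] [NumberField K] {N : ℕ}

/-- **No continuation ⇒ the tree's special value is the junk `0`.** If NO entire function agrees with the Euler product
`L(f/K, φ, s)` on `re s > 3/2`, then `IsRankinSelbergValueHecke f φ s₀ L₀` holds for every `L₀` (vacuously), so the value
is not unique and `rankinSelbergValueHecke f φ s₀ = 0` by definition. [cite: Nekovar1995, §1.6–1.7 (the continuation; here its absence)] -/
theorem rankinSelbergValueHecke_eq_zero_of_not_exists {f : CuspForm (CongruenceSubgroup.Gamma0 N) 2}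
    {φ : HeckeCharacter K} (s₀ : ℂ)
    (h : ¬ ∃ L : ℂ → ℂ, Differentiable ℂ L ∧ ∀ s : ℂ, 3 / 2 < s.re → L s = rankinSelbergEulerProductHecke f φ s) :
    rankinSelbergValueHecke f φ s₀ = 0 := by
  have hall : ∀ x : ℂ, IsRankinSelbergValueHecke f φ s₀ x := fun x L hL hL' ↦ absurd ⟨L, hL, hL'⟩ h
  have hnu : ¬ ∃! L₀ : ℂ, IsRankinSelbergValueHecke f φ s₀ L₀ := by
    rintro ⟨L₀, -, huniq⟩
    have h1 : L₀ + 1 = L₀ := huniq (L₀ + 1) (hall _)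
    have : (1 : ℂ) = 0 := by linear_combination h1
    exact one_ne_zero this
  rw [rankinSelbergValueHecke, dif_neg hnu]

/-- Hence the BDP interpolation value at such a character is `0` (it is a multiple of `rankinSelbergValueHecke f φ 1`).
[cite: Castella2018, Thm. 3.1 (arXiv:1704.06608 p. 9)] -/
theorem bdpInterpolationValue_eq_zero_of_not_exists (p : ℕ) {f : CuspForm (CongruenceSubgroup.Gamma0 N) 2}
    (𝔭 : HeightOneSpectrum (𝓞 K)) {φ : HeckeCharacter K} (n : ℕ) (ΩK : ℂ)
    (h : ¬ ∃ L : ℂ → ℂ, Differentiable ℂ L ∧ ∀ s : ℂ, 3 / 2 < s.re → L s = rankinSelbergEulerProductHecke f φ s) :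
    bdpInterpolationValue p f 𝔭 φ n ΩK = 0 := by
  rw [bdpInterpolationValue_eq, rankinSelbergValueHecke_eq_zero_of_not_exists 1 h, mul_zero, zero_div]

end Junk

/-! ## §2 Cross-period rigidity against a continuation-conditional frame, or the handed frame is `0` -/

section AnyPrime

variable {p : ℕ} [hp : Fact p.Prime] {K : Type} [Field K] [NumberField K] {N : ℕ}
  {ι : PadicAlgCl p ≃+* ℂ} {𝔭 : HeightOneSpectrum (𝓞 K)} {κ : ZpExtension K p}
  {γ : Field.absoluteGaloisGroup K} {f : CuspForm (CongruenceSubgroup.Gamma0 N) 2}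
  {ΩK ΩK' : ℂ} {Ωp Ωp' : ℂ_[p]} {L L' : UnrSeries p}

/-- **The junk dichotomy + R∞.** `K` imaginary quadratic, `κ` anticyclotomic with topological generator `γ`, non-zero periods.
Let `L` satisfy `IsBDPLFunction ι 𝔭 κ γ f Ω_K Ω_p L` and let `L′ ∈ R₀⟦T⟧` take the BDP value at `(Ω′_K, Ω′_p)` at every
`(φ, n, r)` of the range for which `L(f/K, φ, s)` HAS an entire continuation. Then `L = 0` or `Ideal.span {L′} = Ideal.span {L}`.
Proof. Along the supply `φ_k = φ₀^{p^k}` (points `x_k = x₀^{p^k} − 1 → 0`, `x_k ≠ 0`): if the continuation fails at infinitely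
many `k`, `L(x_k) = 0` there (junk value), so `L = 0` (identity principle). Otherwise it holds for `k ≥ K₁`; shift the supply,
read `L′(x_k) = β^{m p^k}·L(x_k)` (`X11b.frameValue_rescale`), get the power-type functional equation
(`powerMap_identity_of_values`), hence `p^a L′ = p^b (w L)` with `w` a unit (`exists_C_pow_mul_eq_of_powerMap_identity`), and
`a = b` by comparing norms at two indices where `L(x_k) ≠ 0` (as in `span_singleton_eq_of_isBDPLFunction`).
[cite: Castella2018, Thm. 3.1 (arXiv:1704.06608 p. 9)] [cite: Washington1997, §7.1–7.2] -/
theorem eq_zero_or_span_singleton_eq_of_isBDPLFunction_of_cont (hK : IsImaginaryQuadratic K)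
    (hκ : κ.IsAnticyclotomic) (hγ : κ.IsTopGenerator γ) (hΩK : ΩK ≠ 0) (hΩK' : ΩK' ≠ 0) (hΩp : Ωp ≠ 0)
    (hΩp' : Ωp' ≠ 0) (hL : IsBDPLFunction ι 𝔭 κ γ f ΩK Ωp L)
    (hL' : ∀ (φ : HeckeCharacter K) (n : ℕ), 0 < n → (∀ v : HeightOneSpectrum (𝓞 K), φ.IsUnramifiedAt v) →
      φ.HasInfinityType (fun _ ↦ (n : ℤ)) (fun _ ↦ -(n : ℤ)) →
      ∀ r : FramedGaloisRep K (PadicAlgCl p) 1, IsPAdicAvatarOf ι φ r → FactorsThroughZp κ r →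
      (∃ Lc : ℂ → ℂ, Differentiable ℂ Lc ∧
        ∀ s : ℂ, 3 / 2 < s.re → Lc s = rankinSelbergEulerProductHecke f φ s) →
      L'.HasValueAt (avatarValueAt r γ - 1)
        (((ι.symm (bdpInterpolationValue p f 𝔭 φ n ΩK') : PadicAlgCl p) : ℂ_[p]) * Ωp' ^ (4 * n))) :
    L = 0 ∨ Ideal.span ({L'} : Set (UnrSeries p)) = Ideal.span {L} := by
  by_cases h0 : L = 0
  · exact Or.inl h0
  right
  -- the supply of interpolation characters
  obtain ⟨m, x₀, φ, φ', r, r', hm, hx1, hx, hunr, hinf, hr, hrκ, hval, -, -, -, -, -⟩ :=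
    characterSupplyAt (p := p) K ι κ γ hK hκ hγ
  set x : ℕ → ℂ_[p] := fun k ↦ x₀ ^ p ^ k - 1 with hxdef
  have hT0 : Tendsto x atTop (𝓝 0) := by
    have := hx.sub_const 1
    simpa [hxdef] using this
  have hx0 : ∀ k, x k ≠ 0 := fun k ↦ sub_ne_zero.mpr (hx1 k)
  have hnpos : ∀ k, 0 < m * p ^ k := fun k ↦ Nat.mul_pos hm (pow_pos hp.out.pos _)
  -- the values of the handed frame at `x k`
  set V : ℕ → ℂ_[p] := fun k ↦
    ((ι.symm (bdpInterpolationValue p f 𝔭 (φ k) (m * p ^ k) ΩK) : PadicAlgCl p) : ℂ_[p]) *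
      Ωp ^ (4 * (m * p ^ k)) with hVdef
  set β : ℂ_[p] := ((ι.symm ((ΩK / ΩK') ^ 4) : PadicAlgCl p) : ℂ_[p]) * (Ωp' / Ωp) ^ 4 with hβdef
  have hβ0 : β ≠ 0 := by
    refine mul_ne_zero ?_ (pow_ne_zero _ (div_ne_zero hΩp' hΩp))
    rw [PadicComplex.coe_eq]
    exact (map_ne_zero_iff _ (algebraMap (PadicAlgCl p) ℂ_[p]).injective).mpr
      ((map_ne_zero_iff _ ι.symm.injective).mpr (pow_ne_zero _ (div_ne_zero hΩK hΩK')))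
  have hLval : ∀ k, L.HasValueAt (x k) (V k) := fun k ↦ by
    have h := hL.hasValueAt (hnpos k) (hunr k) (hinf k) (hr k) (hrκ k)
    rwa [hval] at h
  -- eventually `‖x k‖ < 1`
  have hev : ∀ᶠ k in atTop, ‖x k‖ < 1 := by
    have h := hT0.norm
    rw [norm_zero] at h
    exact h.eventually (gt_mem_nhds zero_lt_one)
  -- JUNK DICHOTOMY: the continuation holds eventually along the supply (otherwise `L = 0`)
  have hcont : ∀ᶠ k in atTop, ∃ Lc : ℂ → ℂ, Differentiable ℂ Lc ∧
      ∀ s : ℂ, 3 / 2 < s.re → Lc s = rankinSelbergEulerProductHecke f (φ k) s := by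
    by_contra hcon
    rw [Filter.not_eventually] at hcon
    obtain ⟨σ, hσ, hσP⟩ := Filter.extraction_of_frequently_atTop hcon
    apply h0
    refine unrSeries_eq_of_hasValueAt (x := fun k ↦ x (σ k)) (v := fun _ ↦ 0)
      (hT0.comp hσ.tendsto_atTop) (Frequently.of_forall fun k ↦ hx0 _) (fun k ↦ ?_)
      (fun k ↦ hasValueAt_zero_series _)
    have hV0 : V (σ k) = 0 := by
      simp only [hVdef]
      rw [bdpInterpolationValue_eq_zero_of_not_exists p 𝔭 (m * p ^ σ k) ΩK (hσP k), map_zero]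
      simp
    have h := hLval (σ k)
    rwa [hV0] at h
  obtain ⟨K₁, hK₁⟩ := eventually_atTop.mp hcont
  -- the values of the conditional frame at `x k`, `k ≥ K₁`
  have hL'val : ∀ k, K₁ ≤ k → L'.HasValueAt (x k) (V k * β ^ (m * p ^ k)) := fun k hk ↦ by
    have h := hL' (φ k) (m * p ^ k) (hnpos k) (hunr k) (hinf k) (r k) (hr k) (hrκ k) (hK₁ k hk)
    rw [frameValue_rescale ι f 𝔭 (φ k) (m * p ^ k) hΩK hΩK' Ωp' hΩp, hval] at h
    exact h
  -- `V k ≠ 0` frequently (identity principle: otherwise `L = 0`)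
  have hfreq : ∃ᶠ k in atTop, V k ≠ 0 := by
    by_contra hcon
    have hV : ∀ᶠ k in atTop, V k = 0 := by simpa [Filter.not_frequently] using hcon
    obtain ⟨K₂, hK₂⟩ := eventually_atTop.mp hV
    apply h0
    refine unrSeries_eq_of_hasValueAt (x := fun k ↦ x (k + K₂)) (v := fun _ ↦ 0)
      (hT0.comp (tendsto_add_atTop_nat K₂))
      (Frequently.of_forall fun k ↦ hx0 _) (fun k ↦ ?_)
      (fun k ↦ hasValueAt_zero_series _)
    have h := hLval (k + K₂)
    rwa [hK₂ (k + K₂) (Nat.le_add_left K₂ k)] at h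
  -- good indices: `‖x k‖ < 1`, `V k ≠ 0`, `K₁ ≤ k`
  have hgood : ∃ᶠ k in atTop, ‖x k‖ < 1 ∧ V k ≠ 0 ∧ K₁ ≤ k :=
    (hfreq.and_eventually (hev.and (eventually_ge_atTop K₁))).mono fun k h ↦ ⟨h.2.1, h.1, h.2.2⟩
  -- `L' ≠ 0`
  have h0' : L' ≠ 0 := by
    obtain ⟨k, hxk, hVk, hk⟩ := hgood.exists
    intro hz
    have h1 := hL'val k hk
    rw [hz] at h1
    have h2 : V k * β ^ (m * p ^ k) = 0 := h1.unique (hasValueAt_zero_series _)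
    exact (mul_ne_zero hVk (pow_ne_zero _ hβ0)) h2
  -- the shifted supply `k ↦ k + K₃` with `‖x‖ < 1` and the continuation available
  obtain ⟨K₀, hK₀⟩ : ∃ K₀, ∀ k ≥ K₀, ‖x k‖ < 1 := eventually_atTop.mp hev
  set K₃ : ℕ := max K₀ K₁ with hK₃
  have hxK : ∀ k, ‖x (k + K₃)‖ < 1 := fun k ↦
    hK₀ _ (le_trans (le_max_left K₀ K₁) (Nat.le_add_left K₃ k))
  have hK₁K : ∀ k, K₁ ≤ k + K₃ := fun k ↦ le_trans (le_max_right K₀ K₁) (Nat.le_add_left K₃ k)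
  -- R∞ step 1: the power-type functional equation, from values
  have hid := powerMap_identity_of_values (p := p) (L := L) (L' := L') (x := fun k ↦ x (k + K₃))
    (V := fun k ↦ V (k + K₃)) (n := fun k ↦ m * p ^ (k + K₃)) (A := 1) (β := β)
    hxK (fun k ↦ hx0 _) (hT0.comp (tendsto_add_atTop_nat K₃)) (fun k ↦ ?_) (fun k ↦ ?_)
    (fun k ↦ hLval _) (fun k ↦ ?_)
  rotate_left
  · show x₀ ^ p ^ (k + 1 + K₃) - 1 = (1 + (x₀ ^ p ^ (k + K₃) - 1)) ^ p - 1
    have e : k + 1 + K₃ = k + K₃ + 1 := by omega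
    rw [e, add_sub_cancel, ← pow_mul, ← pow_succ]
  · show m * p ^ (k + 1 + K₃) = p * (m * p ^ (k + K₃))
    have e : k + 1 + K₃ = k + K₃ + 1 := by omega
    rw [e, pow_succ]
    ring
  · have h := hL'val (k + K₃) (hK₁K k)
    rw [one_mul, mul_comm]
    exact h
  -- R∞ step 2: `p^a L' = p^b (w L)`
  obtain ⟨a, b, w, hw, hrel⟩ := exists_C_pow_mul_eq_of_powerMap_identity h0 h0' hid
  -- norms of the constants
  obtain ⟨hp0, hp1⟩ := norm_natCast_p_pos_and_lt_one (p := p)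
  have hcoe : ∀ c : ℕ, ((((p : ℕ) : unrIntegers p) ^ c : unrIntegers p) : ℂ_[p]) =
      ((p : ℕ) : ℂ_[p]) ^ c := fun c ↦ coe_natCast_pow c
  -- at a good index: `‖p‖^a ‖β‖^{m p^k} = ‖p‖^b`
  have hE : ∀ k, ‖x k‖ < 1 → V k ≠ 0 → K₁ ≤ k →
      ‖((p : ℕ) : ℂ_[p])‖ ^ a * ‖β‖ ^ (m * p ^ k) = ‖((p : ℕ) : ℂ_[p])‖ ^ b := by
    intro k hxk hVk hk
    obtain ⟨ω, hω⟩ := exists_hasValueAt w hxk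
    have hω1 : ‖ω‖ = 1 := norm_value_eq_one_of_isUnit hw hxk hω
    have hlhs : UnrSeries.HasValueAt (PowerSeries.C (((p : ℕ) : unrIntegers p) ^ a) * L') (x k)
        ((((p : ℕ) : ℂ_[p]) ^ a) * (V k * β ^ (m * p ^ k))) := by
      rw [← hcoe]; exact hasValueAt_C_mul _ (hL'val k hk)
    have hrhs : UnrSeries.HasValueAt (PowerSeries.C (((p : ℕ) : unrIntegers p) ^ b) * (w * L)) (x k)
        ((((p : ℕ) : ℂ_[p]) ^ b) * (ω * V k)) := by
      rw [← hcoe]; exact hasValueAt_C_mul _ (hasValueAt_mul hxk hω (hLval k))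
    rw [hrel] at hlhs
    have heq : (((p : ℕ) : ℂ_[p]) ^ a) * (V k * β ^ (m * p ^ k)) =
        (((p : ℕ) : ℂ_[p]) ^ b) * (ω * V k) := hlhs.unique hrhs
    have hn := congrArg (‖·‖) heq
    simp only [norm_mul, norm_pow, hω1, one_mul] at hn
    have hV0 : ‖V k‖ ≠ 0 := norm_ne_zero_iff.mpr hVk
    have : ‖((p : ℕ) : ℂ_[p])‖ ^ a * ‖β‖ ^ (m * p ^ k) * ‖V k‖ =
        ‖((p : ℕ) : ℂ_[p])‖ ^ b * ‖V k‖ := by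
      rw [← hn]; ring
    exact mul_right_cancel₀ hV0 this
  -- two good indices `k₁ < k₂`
  obtain ⟨k₁, hx₁, hV₁, hk₁⟩ := hgood.exists
  obtain ⟨k₂, hk₂, hx₂, hV₂, hk₂'⟩ := (frequently_atTop.mp hgood) (k₁ + 1)
  have hE₁ := hE k₁ hx₁ hV₁ hk₁
  have hE₂ := hE k₂ hx₂ hV₂ hk₂'
  -- `‖β‖^{m p^{k₁}} = 1`
  set y : ℝ := ‖β‖ ^ (m * p ^ k₁) with hydef
  have hy0 : 0 ≤ y := pow_nonneg (norm_nonneg _) _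
  have hpa : 0 < ‖((p : ℕ) : ℂ_[p])‖ ^ a := pow_pos hp0 a
  have hyy : y ^ p ^ (k₂ - k₁) = y := by
    have h12 : ‖β‖ ^ (m * p ^ k₂) = y ^ p ^ (k₂ - k₁) := by
      rw [hydef, ← pow_mul]
      congr 1
      rw [mul_assoc, ← pow_add, Nat.add_sub_cancel' (by omega : k₁ ≤ k₂)]
    have := hE₂
    rw [h12, ← hE₁] at this
    exact mul_left_cancel₀ hpa.ne' this
  have hy1 : y = 1 := by
    have hyne : y ≠ 0 := by
      intro hy
      rw [hy, mul_zero] at hE₁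
      exact (pow_pos hp0 b).ne hE₁
    have hsplit : y ^ p ^ (k₂ - k₁) = y ^ (p ^ (k₂ - k₁) - 1) * y := by
      rw [← pow_succ, Nat.sub_add_cancel (Nat.one_le_pow _ _ hp.out.pos)]
    rw [hsplit] at hyy
    have hpow : y ^ (p ^ (k₂ - k₁) - 1) = 1 := by
      have : y ^ (p ^ (k₂ - k₁) - 1) * y = 1 * y := by rw [hyy, one_mul]
      exact mul_right_cancel₀ hyne this
    have he : p ^ (k₂ - k₁) - 1 ≠ 0 := by
      have : 2 ≤ p ^ (k₂ - k₁) := by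
        calc 2 ≤ p := hp.out.two_le
          _ = p ^ 1 := (pow_one p).symm
          _ ≤ p ^ (k₂ - k₁) := Nat.pow_le_pow_right hp.out.pos (by omega)
      omega
    exact (pow_eq_one_iff_of_nonneg hy0 he).mp hpow
  -- hence `a = b`
  have hab : a = b := by
    rw [hy1, mul_one] at hE₁
    exact pow_right_injective₀ hp0 hp1.ne hE₁
  -- cancel `p^a` : `L' = w L`
  rw [hab] at hrel
  have hC0 : PowerSeries.C (((p : ℕ) : unrIntegers p) ^ b) ≠ (0 : UnrSeries p) := by
    intro hC
    have h1 : (((p : ℕ) : unrIntegers p) ^ b : unrIntegers p) = 0 := by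
      have := congrArg PowerSeries.constantCoeff hC
      simpa using this
    have h2 : ((((p : ℕ) : unrIntegers p) ^ b : unrIntegers p) : ℂ_[p]) = 0 := by
      rw [h1]; rfl
    rw [hcoe] at h2
    exact (pow_pos hp0 b).ne' (by rw [← norm_pow, h2, norm_zero])
  have hLw : L' = w * L := mul_left_cancel₀ hC0 hrel
  rw [hLw]
  exact Ideal.span_singleton_mul_left_unit hw L

end AnyPrime

/-! ## §3 The toric instance: `spec (p^k) L₂` against the handed BDP frame, with NO continuation hypothesis -/

section Toric

variable {p : ℕ} [Fact p.Prime]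

/-- **K3 of line `thin_comb` without K3c.** `K` imaginary quadratic, `p = 𝔭𝔭′` split, `κ` anticyclotomic with topological
generator `γ`, `(κ₁, κ₂; γ₁, γ₂)` a generator pair with the v2 frame relations `γ₁γ⁻¹ ∈ ker κ`, `γ₂(γ^{p^k})⁻¹ ∈ ker κ`. If `L`
is a BDP frame of `f` at `(Ω_K, Ω_p)` (the crux's handed frame) and `L₂` a toric two-variable frame at `(Ω′_K, Ω′_p)`, then
`L = 0` or `Ideal.span {spec (p^k) L₂} = Ideal.span {L}`: at a character `φ` of the BDP range ADMITTING a continuation, the toric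
frame gives the BDP value of `spec (p^k) L₂` at `φ̂(γ) − 1` (the pointwise content of `stub_lineRestrictionIsBDP`, p704137:
`φ(𝔭′) = φ(𝔭)⁻¹` by `KatzLineFrame`, `hasValueAt₂_centralRay`, line geometry and `LineValue`), which is all §2 asks for.
[cite: CastellaWan2023, §2.4 Cor. 2.12 (arXiv:1607.02019)] [cite: Castella2018, Thm. 3.1] -/
theorem eq_zero_or_span_spec_eq_of_toric
    (K : Type) [Field K] [NumberField K] (N : ℕ) (f : CuspForm (CongruenceSubgroup.Gamma0 N) 2)
    (hK : IsImaginaryQuadratic K) (κ : ZpExtension K p) (hκ : κ.IsAnticyclotomic) (γ : Field.absoluteGaloisGroup K)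
    (hγ : κ.IsTopGenerator γ) (𝔭 : HeightOneSpectrum (𝓞 K)) (h𝔭 : ((p : ℕ) : 𝓞 K) ∈ 𝔭.asIdeal)
    (𝔭' : HeightOneSpectrum (𝓞 K)) (h𝔭' : ((p : ℕ) : 𝓞 K) ∈ 𝔭'.asIdeal) (hne : 𝔭' ≠ 𝔭)
    (ι : PadicAlgCl p ≃+* ℂ) (κ₁ κ₂ : ZpExtension K p) (γ₁ γ₂ : Field.absoluteGaloisGroup K) (k : ℕ)
    (hpair : ZpExtension.IsTopGeneratorPair κ₁ κ₂ γ₁ γ₂)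
    (hγ₁ : γ₁ * γ⁻¹ ∈ κ.kerSubgroup) (hγ₂ : γ₂ * (γ ^ (p ^ k))⁻¹ ∈ κ.kerSubgroup)
    {ΩK : ℂ} {Ωp : ℂ_[p]} {L : UnrSeries p} (hΩK : ΩK ≠ 0) (hΩp : Ωp ≠ 0)
    (hL : IsBDPLFunction ι 𝔭 κ γ f ΩK Ωp L)
    {ΩK' : ℂ} {Ωp' : ℂ_[p]} {L₂ : PowerSeries (UnrSeries p)} (hΩK' : ΩK' ≠ 0) (hΩp' : Ωp' ≠ 0)
    (hL₂ : IsToricTwoVarLFunction ι 𝔭 𝔭' κ₁ κ₂ γ₁ γ₂ f ΩK' Ωp' L₂) :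
    L = 0 ∨ Ideal.span ({TwoVarSubst.spec (p ^ k) L₂} : Set (UnrSeries p)) = Ideal.span {L} := by
  refine eq_zero_or_span_singleton_eq_of_isBDPLFunction_of_cont hK hκ hγ hΩK hΩK' hΩp hΩp' hL ?_
  intro φ n hn hunr hinf r hr hκr hcont
  obtain ⟨Lc, hLd, hLe⟩ := hcont
  -- the avatar factors through the pair
  have hpr : FactorsThroughPair κ₁ κ₂ r :=
    PrintCf2.GeneratorPairSupply.factorsThroughPair_of_factorsThroughZp_of_isImaginaryQuadratic hK hpair κ hκr
  -- `φ(𝔭′) = φ(𝔭)⁻¹`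
  haveI : IsCMField K := hK.isCMField
  have hφc := KatzLineFrame.galConj_complexConj_eq_inv_of_factorsThroughZp hK ι hκ hr hκr hunr
  have hsmul : IsCMField.complexConj K • 𝔭 = 𝔭' :=
    KatzLineFrame.complexConj_smul_eq_of_ne hK (Fact.out : p.Prime) h𝔭 h𝔭' hne
  have hψ : heckeValueExtZero φ 𝔭' = (heckeValueExtZero φ 𝔭)⁻¹ := by
    rw [heckeValueExtZero_of_isUnramifiedAt (hunr _), heckeValueExtZero_of_isUnramifiedAt (hunr _), ← hsmul]
    exact KatzLineFrame.valueAtUniformizer_smul_of_galConj_eq_inv hφc hunr 𝔭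
  -- the two-variable value on the central ray, read on the line
  have h2 := hL₂.hasValueAt₂_centralRay hn hinf hunr hψ hr hpr hLd hLe
  rw [LineGeometry.interpolationPoint_mem_line hκr hγ₁ hγ₂, LineGeometry.avatarValueAt_frame_fst hκr hγ₁] at h2
  have hx : ‖avatarValueAt r γ - 1‖ < 1 := ZpExtension.norm_avatarValueAt_sub_one_lt hκr hγ
  exact (LineValue.hasValueAt₂_line_iff_hasValueAt_spec (p ^ k) L₂ hx _).mp h2

end Toric

end Summit.BirchSwinnertonDyer.BirchSwinnertonDyer.Theorems.UniversalToricDescentThinComb.ContRigidity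

end
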